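import Summits.SmoothPoincare4.SmoothPoincare4.Theorems.ConvexBisectionAcyclicBisectionExistsDualHandleModelMap
import HarnessLib

/-!
# Dual handles, X-a: the ridge curve and the `μ`-scaling of the model push of `X₁`
(brick (PUSH-a) of the sub-goal T3b step (ii) "push the prefix sub-handlebody `X₁` off the cocore
neighbourhood `N` of the suffix handles" of stub `stub_steinRealisation` (NF6), line
`modp-braid-orbits` r11, crux `ConvexBisection.AcyclicBisectionExists`, item
stmt-SmoothPoincare4-10508; wave 3, lead c5, worker Z3)

Coordinates of the model `ℝ⁴ = ℝ²_λ × ℝ²_μ` around the `j`-th belt circle (`…DualHandleModelMap.lean`):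
`P = ‖x_λ‖²`, `Q = ‖x_μ‖²`, handle side `‖x‖ ≤ 1`, cocore disc `{P = 0}`.  The model push
`sh = Φ₂ ∘ Φ₁` (`…DualHandlePush.lean`) is a composite of two maps of the quarter plane `(P, Q)`
keeping the torus directions `x̂_λ`, `x̂_μ`; this file is the scalar part of `Φ₁`, the `μ`-scaling
at fixed `P`: `Q ↦ Q · ϱ(P)/(1 - P)`, where `ϱ = ridge κ δ` is the lower boundary `Q = ϱ(P)` of the
cocore neighbourhood above the blend zone (V5 report §3.2, written `𝒸` there),

    ϱ(P) = ω(P/κ²) (1 - P) + (1 - ω(P/κ²)) δP/κ²,   ω = shellCut;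

the factor `muScaleSq κ δ P = ϱ(P)/(1 - P)` is written with the flat quotient
`shellCoDiv κ P = (1 - ω(P/κ²))/(1 - P)` (extended by `0`, smooth on `ℝ`), so it is ONE smooth
function on `ℝ`, equal to `1` for `P ≥ 3κ²/4` (there `Φ₁ = id`) and to `δP/(κ²(1-P))` for
`P ≤ κ²/2` (there `Φ₁` maps the handle `{Q ≤ 1 - P}` onto the cone `{Q ≤ δP/κ²}`).
Only structural facts about `Real.smoothTransition` are used (plateaus, `0 ≤ S ≤ 1`).
Everything here is proved; no named facts.

## References
* J. Milnor, *Lectures on the h-cobordism theorem* (1965), §3 (dual handles). [MilnorHCobordism1965]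
* A. A. Kosinski, *Differential Manifolds* (1993), VI §6. [Kosinski1993]
-/

noncomputable section

-- the prescribed namespace `Summit.<P>.<Sub>.…` duplicates `SmoothPoincare4` (P = Sub)
set_option linter.dupNamespace false

open scoped Manifold ContDiff Topology

namespace Summit.SmoothPoincare4.SmoothPoincare4.Theorems.AcyclicBisectionExists.ModpBraidOrbits

open Set Function Metric
open Literature.Topology.FourManifolds Literature.Topology.FourManifolds.HandleAttachingMap

namespace PushModel

/-! ### §1 The ridge curve `ϱ` and the `μ`-scaling factor of `Φ₁` -/

section Ridge

/-- **The ridge `ϱ(P) = ω(P/κ²)(1 - P) + (1 - ω(P/κ²)) δP/κ²`**: the lower boundary `Q = ϱ(P)` of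
the upper part of the cocore neighbourhood `N` (V5 report §3.2, there written `𝒸`). [folklore] -/
def ridge (κ δ P : ℝ) : ℝ :=
  shellCut (P / κ ^ 2) * (1 - P) + (1 - shellCut (P / κ ^ 2)) * (δ * P / κ ^ 2)

/-- Below the blend zone the ridge is the cone line `Q = δP/κ²`. [folklore] -/
theorem ridge_of_le {κ δ P : ℝ} (hκ : 0 < κ) (hP : P ≤ κ ^ 2 / 2) : ridge κ δ P = δ * P / κ ^ 2 := by
  have h : P / κ ^ 2 ≤ 1 / 2 := by rw [div_le_iff₀ (by positivity)]; linarith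
  rw [ridge, shellCut_of_le h]; ring

/-- Above the blend zone the ridge is the seam `Q = 1 - P`. [folklore] -/
theorem ridge_of_ge {κ δ P : ℝ} (hκ : 0 < κ) (hP : 3 * κ ^ 2 / 4 ≤ P) : ridge κ δ P = 1 - P := by
  have h : 3 / 4 ≤ P / κ ^ 2 := by rw [le_div_iff₀ (by positivity)]; linarith
  rw [ridge, shellCut_of_ge h]; ring

/-- The ridge lies below the seam: `ϱ(P) ≤ 1 - P` (`κ, δ ≤ 1/2`). [folklore] -/
theorem ridge_le {κ δ : ℝ} (hκ : 0 < κ) (hκ2 : κ ≤ 1 / 2) (hδ : 0 < δ) (hδ2 : δ ≤ 1 / 2)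
    (P : ℝ) : ridge κ δ P ≤ 1 - P := by
  rcases le_or_gt (3 * κ ^ 2 / 4) P with h | h
  · rw [ridge_of_ge hκ h]
  · have hω := shellCut_mem (P / κ ^ 2)
    have hκsq : κ ^ 2 ≤ 1 / 4 := by nlinarith
    have h1 : δ * P / κ ^ 2 ≤ 1 - P := by
      rw [div_le_iff₀ (by positivity)]
      nlinarith
    unfold ridge
    nlinarith

/-- The ridge is positive for `0 < P < 1`. [folklore] -/
theorem ridge_pos {κ δ P : ℝ} (hκ : 0 < κ) (hδ : 0 < δ) (hP : 0 < P) (hP1 : P < 1) :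
    0 < ridge κ δ P := by
  have hω := shellCut_mem (P / κ ^ 2)
  have h1 : 0 < δ * P / κ ^ 2 := by positivity
  unfold ridge
  rcases eq_or_lt_of_le hω.2 with h | h
  · rw [h]; linarith
  · nlinarith

/-- On the blend zone `κ²/2 ≤ P ≤ 3κ²/4` the ridge is at least `δ/2`. [folklore] -/
theorem half_le_ridge {κ δ P : ℝ} (hκ : 0 < κ) (hκ2 : κ ≤ 1 / 2) (hδ : 0 < δ) (hδ2 : δ ≤ 1 / 2)
    (hP : κ ^ 2 / 2 ≤ P) (hP2 : P ≤ 3 * κ ^ 2 / 4) : δ / 2 ≤ ridge κ δ P := by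
  have hω := shellCut_mem (P / κ ^ 2)
  have hκsq : κ ^ 2 ≤ 1 / 4 := by nlinarith
  have h1 : δ / 2 ≤ δ * P / κ ^ 2 := by
    rw [le_div_iff₀ (by positivity)]; nlinarith [mul_le_mul_of_nonneg_left hP hδ.le]
  have h2 : δ / 2 ≤ 1 - P := by nlinarith
  unfold ridge
  nlinarith

/-- The ridge is continuous (indeed smooth). [folklore] -/
theorem contDiff_ridge (κ δ : ℝ) : ContDiff ℝ ∞ (ridge κ δ) := by
  unfold ridge
  exact ((contDiff_cutTop.comp (contDiff_id.div_const _)).mul (contDiff_const.sub contDiff_id)).add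
    ((contDiff_const.sub (contDiff_cutTop.comp (contDiff_id.div_const _))).mul
      ((contDiff_const.mul contDiff_id).div_const _))

/-- The flat quotient `(1 - ω(P/κ²))/(1 - P)`, extended by `0` across `P ≥ 1` (it vanishes
identically on `P > 3κ²/4`). [folklore] -/
def shellCoDiv (κ P : ℝ) : ℝ := if P < 1 then (1 - shellCut (P / κ ^ 2)) / (1 - P) else 0

/-- `shellCoDiv` vanishes on `P ≥ 3κ²/4`. [folklore] -/
theorem shellCoDiv_of_ge {κ P : ℝ} (hκ : 0 < κ) (hP : 3 * κ ^ 2 / 4 ≤ P) : shellCoDiv κ P = 0 := by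
  have h : 3 / 4 ≤ P / κ ^ 2 := by rw [le_div_iff₀ (by positivity)]; linarith
  unfold shellCoDiv
  split_ifs
  · rw [shellCut_of_ge h]; ring
  · rfl

/-- `shellCoDiv` below `P = 1`. [folklore] -/
theorem shellCoDiv_of_lt_one {κ P : ℝ} (hP : P < 1) :
    shellCoDiv κ P = (1 - shellCut (P / κ ^ 2)) / (1 - P) := by
  rw [shellCoDiv, if_pos hP]

/-- **`shellCoDiv κ` is smooth on `ℝ`** (`κ ≤ 1/2`: it is a smooth quotient on `P < 1` and zero on
`P > 3κ²/4`). [folklore] -/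
theorem contDiff_shellCoDiv {κ : ℝ} (hκ : 0 < κ) (hκ2 : κ ≤ 1 / 2) : ContDiff ℝ ∞ (shellCoDiv κ) := by
  rw [contDiff_iff_contDiffAt]
  intro P
  by_cases hP : P < 1
  · have hev : shellCoDiv κ =ᶠ[𝓝 P] fun t => (1 - shellCut (t / κ ^ 2)) / (1 - t) := by
      filter_upwards [Iio_mem_nhds hP] with t ht
      rw [shellCoDiv_of_lt_one ht]
    refine ContDiffAt.congr_of_eventuallyEq ?_ hev
    exact ((contDiff_const.sub (contDiff_cutTop.comp (contDiff_id.div_const _))).contDiffAt).div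
      (contDiff_const.sub contDiff_id).contDiffAt (sub_ne_zero.2 (ne_of_gt hP))
  · have hκsq : κ ^ 2 ≤ 1 / 4 := by nlinarith
    have hlt : 3 * κ ^ 2 / 4 < P := by linarith [not_lt.1 hP]
    have hev : shellCoDiv κ =ᶠ[𝓝 P] fun _ => (0 : ℝ) := by
      filter_upwards [Ioi_mem_nhds hlt] with t ht
      rw [shellCoDiv_of_ge hκ (le_of_lt ht)]
    exact contDiffAt_const.congr_of_eventuallyEq hev

/-- **The squared `μ`-scaling factor of `Φ₁`**: `ω(P/κ²) + shellCoDiv κ P · δP/κ²`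
(`= ϱ(P)/(1-P)` for `P < 1`). [folklore] -/
def muScaleSq (κ δ P : ℝ) : ℝ := shellCut (P / κ ^ 2) + shellCoDiv κ P * (δ * P / κ ^ 2)

/-- `muScaleSq = ϱ(P)/(1 - P)` for `P < 1`. [folklore] -/
theorem muScaleSq_eq {κ δ P : ℝ} (hκ : 0 < κ) (hP : P < 1) : muScaleSq κ δ P = ridge κ δ P / (1 - P) := by
  have h1 : (1 : ℝ) - P ≠ 0 := sub_ne_zero.2 (ne_of_gt hP)
  have h2 : κ ^ 2 ≠ 0 := by positivity
  rw [muScaleSq, shellCoDiv_of_lt_one hP, ridge]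
  field_simp

/-- `(1 - P) · muScaleSq = ϱ(P)` for `P < 1`. [folklore] -/
theorem one_sub_mul_muScaleSq {κ δ P : ℝ} (hκ : 0 < κ) (hP : P < 1) :
    (1 - P) * muScaleSq κ δ P = ridge κ δ P := by
  have h1 : (1 : ℝ) - P ≠ 0 := sub_ne_zero.2 (ne_of_gt hP)
  rw [muScaleSq_eq hκ hP]; field_simp

/-- `muScaleSq = 1` on `P ≥ 3κ²/4` (`Φ₁` is the identity there). [folklore] -/
theorem muScaleSq_of_ge {κ δ P : ℝ} (hκ : 0 < κ) (hP : 3 * κ ^ 2 / 4 ≤ P) : muScaleSq κ δ P = 1 := by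
  have h : 3 / 4 ≤ P / κ ^ 2 := by rw [le_div_iff₀ (by positivity)]; linarith
  rw [muScaleSq, shellCoDiv_of_ge hκ hP, shellCut_of_ge h]; ring

/-- `muScaleSq = δP/(κ²(1-P))` on `P ≤ κ²/2`. [folklore] -/
theorem muScaleSq_of_le {κ δ P : ℝ} (hκ : 0 < κ) (hκ2 : κ ≤ 1 / 2) (hP : P ≤ κ ^ 2 / 2) :
    muScaleSq κ δ P = δ * P / (κ ^ 2 * (1 - P)) := by
  have hκsq : κ ^ 2 ≤ 1 / 4 := by nlinarith
  have hP1 : P < 1 := by linarith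
  have h1 : (1 : ℝ) - P ≠ 0 := sub_ne_zero.2 (ne_of_gt hP1)
  rw [muScaleSq_eq hκ hP1, ridge_of_le hκ hP]
  field_simp

/-- `muScaleSq > 0` for `P > 0` (`κ, δ ≤ 1/2`). [folklore] -/
theorem muScaleSq_pos {κ δ P : ℝ} (hκ : 0 < κ) (hκ2 : κ ≤ 1 / 2) (hδ : 0 < δ) (hP : 0 < P) :
    0 < muScaleSq κ δ P := by
  rcases lt_or_ge P 1 with h | h
  · rw [muScaleSq_eq hκ h]; exact div_pos (ridge_pos hκ hδ hP h) (by linarith)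
  · have hκsq : κ ^ 2 ≤ 1 / 4 := by nlinarith
    rw [muScaleSq_of_ge hκ (by linarith)]; exact one_pos

/-- **`muScaleSq κ δ` is smooth on `ℝ`.** [folklore] -/
theorem contDiff_muScaleSq {κ : ℝ} (hκ : 0 < κ) (hκ2 : κ ≤ 1 / 2) (δ : ℝ) :
    ContDiff ℝ ∞ (muScaleSq κ δ) := by
  unfold muScaleSq
  exact (contDiff_cutTop.comp (contDiff_id.div_const _)).add
    ((contDiff_shellCoDiv hκ hκ2).mul ((contDiff_const.mul contDiff_id).div_const _))

end Ridge

end PushModel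

/-- **Registered helper `helper_muScaleSq` (brick (PUSH-a) of T3b (ii), sub-goal of NF6
`stub_steinRealisation`, wave 3, lead c5): the squared `μ`-scaling factor of the model push is a
smooth positive function of `P > 0`, equal to `1` on `P ≥ 3κ²/4`, to `δP/(κ²(1-P))` on `P ≤ κ²/2`,
and `(1 - P) · muScaleSq κ δ P` is the ridge `ϱ(P) ≤ 1 - P` for `P < 1`.** [folklore] -/
theorem helper_muScaleSq : ∀ {κ δ : ℝ}, 0 < κ → κ ≤ 1 / 2 → 0 < δ → δ ≤ 1 / 2 → ContDiff ℝ ∞ (Summit.SmoothPoincare4.SmoothPoincare4.Theorems.AcyclicBisectionExists.ModpBraidOrbits.PushModel.muScaleSq κ δ) ∧ (∀ P : ℝ, 0 < P → 0 < Summit.SmoothPoincare4.SmoothPoincare4.Theorems.AcyclicBisectionExists.ModpBraidOrbits.PushModel.muScaleSq κ δ P) ∧ (∀ P : ℝ, 3 * κ ^ 2 / 4 ≤ P → Summit.SmoothPoincare4.SmoothPoincare4.Theorems.AcyclicBisectionExists.ModpBraidOrbits.PushModel.muScaleSq κ δ P = 1) ∧ (∀ P : ℝ, P ≤ κ ^ 2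 / 2 → Summit.SmoothPoincare4.SmoothPoincare4.Theorems.AcyclicBisectionExists.ModpBraidOrbits.PushModel.muScaleSq κ δ P = δ * P / (κ ^ 2 * (1 - P))) ∧ (∀ P : ℝ, P < 1 → (1 - P) * Summit.SmoothPoincare4.SmoothPoincare4.Theorems.AcyclicBisectionExists.ModpBraidOrbits.PushModel.muScaleSq κ δ P = Summit.SmoothPoincare4.SmoothPoincare4.Theorems.AcyclicBisectionExists.ModpBraidOrbits.PushModel.ridge κ δ P) ∧ (∀ P : ℝ, Summit.SmoothPoincare4.SmoothPoincare4.Theorems.AcyclicBisectionExists.ModpBraidOrbits.PushModel.ridge κ δ P ≤ 1 - P) := by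
  intro κ δ hκ hκ2 hδ hδ2
  exact ⟨PushModel.contDiff_muScaleSq hκ hκ2 δ, fun P hP => PushModel.muScaleSq_pos hκ hκ2 hδ hP,
    fun P hP => PushModel.muScaleSq_of_ge hκ hP, fun P hP => PushModel.muScaleSq_of_le hκ hκ2 hP,
    fun P hP => PushModel.one_sub_mul_muScaleSq hκ hP, fun P => PushModel.ridge_le hκ hκ2 hδ hδ2 P⟩

end Summit.SmoothPoincare4.SmoothPoincare4.Theorems.AcyclicBisectionExists.ModpBraidOrbits

end
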